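import Summits.KontsevichZagierPeriods.KontsevichZagierPeriods.Theorems.IsogenyCertificatesXMapPeriodTransferStubCellMove

/-!
# `XMapKernel` (stmt-KontsevichZagierPeriods-10663), line `derived-datum-quasi-periods` — stub `stub_weightedCellMove`

One cell, one move of rule (2) of the Kontsevich–Zagier calculus, now for QUASI-periods. For an
x-rational isogeny datum `(f, g, c)` between `y² = P(x) = x³ + Ax + B` and
`Y² = Q(X) = X³ + A'X + B'` (Wronskian `W = f'g − fg' ≠ 0` in `ℚ[X]` and certificate identity
`c²·g·(f³ + A'fg² + B'g³) = P·W²`), the real x-map `R y = f(y)/g(y)` has derivative `R' = W/g²`,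
and at a point `y` of the cell locus `L = {P > 0, W ≠ 0}` one has `g(y) ≠ 0`, `c ≠ 0` and the KEY
IDENTITY `Q(R y) = P(y)·(R' y)²/c²` (all of this is the sibling file
`IsogenyCertificatesXMapPeriodTransferStubCellMove`). The only new ingredient is the weight
`b₀ + b₁X` in place of a constant: the JACOBIAN IDENTITY reads
`|c|·(b₀ + b₁R(y))/√P(y) = ((b₀ + b₁R(y))/√Q(R y))·|R' y|`. So on a cell
`K = connectedComponentIn L x₀` on which `R` is injective, the representations
`[K, |c|(b₀ + b₁R)/√P]` and `[R(K), (b₀ + b₁X)/√Q]` differ by ONE instance of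
`KZ.changeOfVariablesRel` along `Φ(x) = R(x 0)`, `Φ' x = (R'(x 0)) • id` (det `= R'(x 0)`), `Φ` being
the `ℚ`-semialgebraic map `f/g` read in the coordinate `x 0` of `ℝ¹`. This is the registered stub
`stub_weightedCellMove` of the line's skeleton; the template is the sibling stub
`XMapPeriodTransferCells.stub_cellMove` (constant weight). No definitions are introduced.

References: M. Kontsevich, D. Zagier, *Periods* (2001), §1.2 rule (2); L. C. Washington,
*Elliptic Curves: Number Theory and Cryptography* (2008), §2.9 (x-rational isogenies / Vélu).
-/

noncomputable section

open Set Filter MeasureTheory Polynomial Topology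
open Literature.NumberTheory.Transcendental
open Literature.ModelTheory.ExponentialFields (IsSemialgebraic)
open Summit.KontsevichZagierPeriods.HermiteRigidity.GenusTwoCycleTransfer
  (det_smul_id_fin_one hasFDerivAt_fin_one)
open Summit.KontsevichZagierPeriods.IsogenyCertificates.LemniscateTwoIsogeny (const_apply_zero_eq)
open Summit.KontsevichZagierPeriods.IsogenyCertificates.XMapPeriodTransferCells
  (cellMove_pointwise)

namespace Summit.KontsevichZagierPeriods.IsogenyCertificates.XMapKernelStubs.WeightedCellMove

/-! ### The Jacobian identity with a weight -/

/-- The JACOBIAN IDENTITY of the weighted move, abstractly: if `P' = P·w²/c²` with `P > 0`,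
`w ≠ 0`, `c ≠ 0`, then `|c|·b/√P = (b/√P')·|w|` for every weight value `b`.
[cite: KontsevichZagier2001, §1.2 rule (2)] -/
theorem weightedCellMove_jacobian {P P' w c b : ℝ} (hP : 0 < P) (hw : w ≠ 0) (hc : c ≠ 0)
    (hkey : P' = P * w ^ 2 / c ^ 2) :
    |c| * b / Real.sqrt P = b / Real.sqrt P' * |w| := by
  have hs : Real.sqrt P' = Real.sqrt P * |w| / |c| := by
    rw [hkey, Real.sqrt_div (mul_nonneg hP.le (sq_nonneg w)), Real.sqrt_mul hP.le,
      Real.sqrt_sq_eq_abs, Real.sqrt_sq_eq_abs]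
  rw [hs]
  have h1 : 0 < Real.sqrt P := Real.sqrt_pos.mpr hP
  have h2 : 0 < |w| := abs_pos.mpr hw
  have h3 : 0 < |c| := abs_pos.mpr hc
  field_simp

/-! ### The stub: one cell, one weighted move of rule (2) -/

/-- **Registered stub `stub_weightedCellMove`** (one cell = one move of rule (2), weight
`b₀ + b₁X`). Along `Φ(x) = R(x 0)` the representations `[cell, |c|(b₀ + b₁R)/√P]` and
`[R(cell), (b₀ + b₁X)/√Q]` differ by a relation: one `KZ.changeOfVariablesRel` instance with
`Φ' x = (W(x 0)/g(x 0)²) • id`, `Φ` `ℚ`-semialgebraic (`f/g` in the coordinate `x 0`) and injective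
on the cell by hypothesis, `R(cell)` the image, and Jacobian identity
`|c|(b₀ + b₁R)/√P = ((b₀ + b₁R)/√(Q∘R))·|R'|` from the certificate identity. (The hypothesis
`g ≠ 0` on the cell is redundant: it follows from the certificate identity on the cell locus.)
[cite: KontsevichZagier2001, §1.2 rule (2)] -/
theorem stub_weightedCellMove : ∀ (A B A' B' : ℤ) (f g : ℚ[X]) (c : ℚ),
    derivative f * g - f * derivative g ≠ 0 →
    C (c ^ 2) * g * (f ^ 3 + C (A' : ℚ) * f * g ^ 2 + C (B' : ℚ) * g ^ 3) =
      (X ^ 3 + C (A : ℚ) * X + C (B : ℚ)) * (derivative f * g - f * derivative g) ^ 2 →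
    ∀ (R W : ℝ → ℝ) (L : Set ℝ), R = (fun y => aeval y f / aeval y g) →
      W = (fun y => aeval y (derivative f * g - f * derivative g)) →
      L = {y : ℝ | 0 < y ^ 3 + (A : ℝ) * y + (B : ℝ) ∧ W y ≠ 0} →
    ∀ x₀ ∈ L, InjOn R (connectedComponentIn L x₀) → (∀ y ∈ connectedComponentIn L x₀, aeval y g ≠ 0) →
      ∀ (b₀ b₁ : ℚ) (rI t : KZ.IntegralRep 1),
        rI.domain = {x | x 0 ∈ connectedComponentIn L x₀} →
        EqOn rI.integrand (fun x => |(c : ℝ)| * ((b₀ : ℝ) + (b₁ : ℝ) * R (x 0)) /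
          Real.sqrt (x 0 ^ 3 + (A : ℝ) * x 0 + (B : ℝ))) rI.domain →
        t.domain = {x | x 0 ∈ R '' connectedComponentIn L x₀} →
        EqOn t.integrand (fun x => ((b₀ : ℝ) + (b₁ : ℝ) * x 0) /
          Real.sqrt (x 0 ^ 3 + (A' : ℝ) * x 0 + (B' : ℝ))) t.domain →
        KZ.of rI - KZ.of t ∈ KZ.relations := by
  intro A B A' B' f g c _hW hI R W L hR hWd hL x₀ _hx₀ hinj _hg b₀ b₁ rI t hrId hrIe htd hte
  -- pointwise readings of the variables `R`, `W` and of the cell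
  have hRy : ∀ y, R y = aeval y f / aeval y g := fun y => by rw [hR]
  have hWy : ∀ y, W y = aeval y (derivative f * g - f * derivative g) := fun y => by rw [hWd]
  have hcell : ∀ x ∈ rI.domain, x 0 ∈ connectedComponentIn L x₀ := fun x hx => by
    rwa [hrId] at hx
  have hdom : ∀ x ∈ rI.domain, 0 < x 0 ^ 3 + (A : ℝ) * x 0 + (B : ℝ) ∧
      aeval (x 0) (derivative f * g - f * derivative g) ≠ 0 := by
    intro x hx
    have h := connectedComponentIn_subset L x₀ (hcell x hx)
    rw [hL] at h
    exact ⟨h.1, hWy (x 0) ▸ h.2⟩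
  have hG : ∀ x ∈ rI.domain, aeval (x 0) g ≠ 0 := fun x hx =>
    (cellMove_pointwise hI (hdom x hx).1 (hdom x hx).2).1
  -- the image of the cell is the target domain
  have htdom : t.domain = (fun (x : Fin 1 → ℝ) (_ : Fin 1) => R (x 0)) '' rI.domain := by
    rw [htd, hrId]
    ext X
    simp only [mem_image, mem_setOf_eq]
    constructor
    · rintro ⟨y, hy, hyX⟩
      refine ⟨fun _ => y, hy, ?_⟩
      rw [← const_apply_zero_eq X]
      funext i
      exact hyX
    · rintro ⟨p, hp, rfl⟩
      exact ⟨p 0, hp, rfl⟩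
  refine KZ.changeOfVariablesRel_subset_relations
    ⟨1, rI, t, fun x _ => R (x 0),
      fun x => (W (x 0) / aeval (x 0) g ^ 2) • ContinuousLinearMap.id ℝ (Fin 1 → ℝ),
      ?_, ?_, ?_, htdom, ?_, rfl⟩
  · -- `Φ` is a `ℚ`-semialgebraic map on the cell: it is `f/g` in the coordinate `x 0`
    refine IsSemialgebraicMapOn.of_forall rI.isSemialgebraic_domain fun _ => ?_
    have h := isSemialgebraicFunOn_aeval_div_aeval rI.isSemialgebraic_domain
      (aeval (MvPolynomial.X 0 : MvPolynomial (Fin 1) ℚ) f)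
      (aeval (MvPolynomial.X 0 : MvPolynomial (Fin 1) ℚ) g)
      (fun x hx => by rw [← aeval_algHom_apply, MvPolynomial.aeval_X]; exact hG x hx)
    refine h.congr fun x _ => ?_
    beta_reduce
    rw [← aeval_algHom_apply, MvPolynomial.aeval_X, ← aeval_algHom_apply, MvPolynomial.aeval_X]
    exact (hRy (x 0)).symm
  · -- derivative `Φ' x = R'(x 0) • id`, `R' = W/g²` (quotient rule)
    intro x hx
    have hd : HasDerivAt R (W (x 0) / aeval (x 0) g ^ 2) (x 0) := by
      rw [hR, hWy]
      refine ((Polynomial.hasDerivAt_aeval f (x 0)).fun_div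
        (Polynomial.hasDerivAt_aeval g (x 0)) (hG x hx)).congr_deriv ?_
      simp only [map_sub, map_mul]
    exact (hasFDerivAt_fin_one R _ x hd).hasFDerivWithinAt
  · -- injectivity on the cell (hypothesis)
    intro p hp q hq h
    have h' : R (p 0) = R (q 0) := congrFun h 0
    have hpq : p 0 = q 0 := hinj (hcell p hp) (hcell q hq) h'
    rw [← const_apply_zero_eq p, ← const_apply_zero_eq q, hpq]
  · -- the weighted Jacobian identity
    intro x hx
    have hmem : (fun _ : Fin 1 => R (x 0)) ∈ t.domain := htdom ▸ mem_image_of_mem _ hx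
    obtain ⟨hGx, hc, hkey⟩ := cellMove_pointwise hI (hdom x hx).1 (hdom x hx).2
    rw [hrIe hx, hte hmem, det_smul_id_fin_one]
    simp only [hRy (x 0), hWy (x 0)]
    exact weightedCellMove_jacobian (hdom x hx).1
      (div_ne_zero (hdom x hx).2 (pow_ne_zero 2 hGx)) hc hkey

end Summit.KontsevichZagierPeriods.IsogenyCertificates.XMapKernelStubs.WeightedCellMove

end
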